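import Literature.Geometry.Lorentzian.AFEndRestrict
import HarnessLib

/-!
# The inverse chart of an end as an open embedding; transporting far fields through it

A short support file (topic `Geometry/Lorentzian`; everything PROVED). Let `e` be an
asymptotically flat end of the `3`-manifold `X`, `Φ = e.dataChart : {R < ‖z‖} → X` its inverse
chart and `Φₑ = e.dataChartExt` the total version.

* `isOpenEmbedding_dataChart'` — `Φ` is an open embedding (a diffeomorphism onto the open end `U`
  followed by the inclusion); `isOpenEmbedding_dataChartExt_comp` — for any open embedding
  `f : A → ℝ³` with range beyond radius `R`, `Φₑ ∘ f : A → X` is an open embedding (the form in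
  which shielding charts of model ends are transported into `X`); `contMDiff_dataChartExt_comp`;
* `mfderiv_coord_mfderiv_dataChartExt` — `dcoord ∘ dΦₑ = id` beyond radius `R`;
* `pullbackBilin_dataChartExt_apply_of_eq` — if a field `F` of bilinear forms on `TX` satisfies
  `F (Φₑ z) = (coord^* H)(Φₑ z)` at a point `z` beyond radius `R`, then `(Φₑ^* F) z = H z`: fields
  which ON THE END are pullbacks along `coord` of fields on `ℝ³` are read back by `Φₑ`;
* `far_subset_range_dataChartExt_comp` — if the range of `f` contains the exterior of a ball of
  radius `ρ`, then the range of `Φₑ ∘ f` contains the far region `e.far ρ`; so for the SOLE end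
  `e` its complement is compact (`isCompact_compl_range_dataChartExt_comp`);
* small complements `dataChartExt_mem`, `coord_dataChartExt_of_lt`, `dataChartExt_coord_of_mem`,
  `dataChartExt_mem_far_iff`, `continuousOn_coord'` on the total chart maps.

## References

* R. Bartnik, *The mass of an asymptotically flat manifold*, CPAM 39 (1986), §1. [Bartnik1986]
* B. O'Neill, *Semi-Riemannian geometry* (1983), Ch. 3, p. 58. [ONeill1983]
-/

noncomputable section

open Bundle Set Filter TopologicalSpace Function Topology
open scoped Manifold ContDiff Topology

namespace Literature.Geometry.Lorentzian

namespace AFEnd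

variable {X : Type} [TopologicalSpace X] [ChartedSpace E3 X] (e : AFEnd X)

/-! ### The inverse chart is an open embedding -/

/-- **The inverse chart `Φ : {R < ‖z‖} → X` is an open embedding** (a diffeomorphism onto the
open end `U` followed by the inclusion). This light-import file is the home of the fact;
`AFEnd.isOpenEmbedding_dataChart` (`EndVolume.lean`, heavy measure-theoretic imports) is a
deprecated alias of it since 2026-08-17 (librarian merge; `AsymptoticallyFlatChart.lean` is at the
400-line limit). [cite: Bartnik1986, §1] -/
theorem isOpenEmbedding_dataChart' : IsOpenEmbedding e.dataChart :=
  e.U.2.isOpenEmbedding_subtypeVal.comp e.chart.symm.toHomeomorph.isOpenEmbedding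

/-- `dataChartExt z ∈ U` for `‖z‖ > R`. [cite: Bartnik1986, §1] -/
theorem dataChartExt_mem {z : E3} (hz : e.R < ‖z‖) : e.dataChartExt z ∈ e.U := by
  rw [e.dataChartExt_of_lt hz]
  exact (e.chart.symm ⟨z, hz⟩).2

/-- `coord (dataChartExt z) = z` for `‖z‖ > R`. [cite: Bartnik1986, §1] -/
theorem coord_dataChartExt_of_lt {z : E3} (hz : e.R < ‖z‖) : e.coord (e.dataChartExt z) = z := by
  rw [e.dataChartExt_of_lt hz, e.coord_dataChart]

/-- A point of the end read back through the chart, `dataChartExt (coord q) = q` on `U`. This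
light-import file is the home of the fact; `AFEnd.dataChartExt_coord`
(`MassCapacitySchwarzschildEnd.lean`, heavy capacity-theory imports) is a deprecated alias of it since
2026-08-17 (librarian merge; `AsymptoticallyFlatChart.lean` is at the 400-line limit).
[cite: Bartnik1986, §1] -/
theorem dataChartExt_coord_of_mem {q : X} (hq : q ∈ e.U) : e.dataChartExt (e.coord q) = q := by
  rw [e.dataChartExt_of_lt (e.lt_norm_coord hq), e.dataChart_coord hq]

/-- `dataChartExt z ∈ far R₁ ↔ R₁ < ‖z‖` for `‖z‖ > R`. [cite: Bartnik1986, §1] -/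
theorem dataChartExt_mem_far_iff {R₁ : ℝ} {z : E3} (hz : e.R < ‖z‖) :
    e.dataChartExt z ∈ e.far R₁ ↔ R₁ < ‖z‖ := by
  rw [e.dataChartExt_of_lt hz, e.dataChart_mem_far_iff]

/-- `coord` is continuous on the end. [folklore] -/
theorem continuousOn_coord' : ContinuousOn e.coord e.U := fun _ hq ↦
  (e.contMDiffAt_coord hq).continuousAt.continuousWithinAt

variable {A : Type*} [TopologicalSpace A]

/-- **`Φₑ ∘ f` is an open embedding** for an open embedding `f : A → ℝ³` ranging beyond radius `R`
(`Φₑ ∘ f = Φ ∘ f̂` with `f̂` the corestriction of `f` to the open exterior region, itself an open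
embedding). [cite: Bartnik1986, §1] -/
theorem isOpenEmbedding_dataChartExt_comp {f : A → E3} (hf : IsOpenEmbedding f)
    (hR : ∀ a, e.R < ‖f a‖) : IsOpenEmbedding (e.dataChartExt ∘ f) := by
  set g : A → exteriorRegion e.R := fun a ↦ ⟨f a, hR a⟩ with hg
  have hg' : IsOpenEmbedding g := by
    refine IsOpenEmbedding.of_comp g (exteriorRegion e.R).2.isOpenEmbedding_subtypeVal ?_
    exact hf
  have heq : e.dataChartExt ∘ f = e.dataChart ∘ g := by
    funext a
    exact e.dataChartExt_of_lt (hR a)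
  rw [heq]
  exact e.isOpenEmbedding_dataChart'.comp hg'

/-- **`Φₑ ∘ f` is smooth** for a smooth `f` ranging beyond radius `R`. [folklore] -/
theorem contMDiff_dataChartExt_comp {EA : Type*} [NormedAddCommGroup EA] [NormedSpace ℝ EA]
    {HA : Type*} [TopologicalSpace HA] {IA : ModelWithCorners ℝ EA HA} [ChartedSpace HA A]
    {f : A → E3} (hf : ContMDiff IA 𝓘(ℝ, E3) ∞ f) (hR : ∀ a, e.R < ‖f a‖) :
    ContMDiff IA (𝓡 3) ∞ (e.dataChartExt ∘ f) := fun a ↦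
  (e.contMDiffAt_dataChartExt (hR a)).comp a (hf a)

/-! ### `dcoord ∘ dΦₑ = id`; reading far fields back through `Φₑ` -/

/-- **`dcoord_{Φₑ z} (dΦₑ_z v) = v`** beyond radius `R` (`coord ∘ Φₑ = id` near `z`). [cite: Bartnik1986, §1] -/
theorem mfderiv_coord_mfderiv_dataChartExt {z : E3} (hz : e.R < ‖z‖) (v : E3) :
    mfderiv (𝓡 3) 𝓘(ℝ, E3) e.coord (e.dataChartExt z) (mfderiv 𝓘(ℝ, E3) (𝓡 3) e.dataChartExt z v) = v := by
  have hev : (e.coord ∘ e.dataChartExt) =ᶠ[𝓝 z] id := by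
    filter_upwards [(isOpen_lt continuous_const continuous_norm).mem_nhds hz] with w hw
    exact e.coord_dataChartExt_of_lt hw
  have hd : MDifferentiableAt 𝓘(ℝ, E3) (𝓡 3) e.dataChartExt z :=
    (e.contMDiffAt_dataChartExt hz).mdifferentiableAt (by simp)
  have hc : MDifferentiableAt (𝓡 3) 𝓘(ℝ, E3) e.coord (e.dataChartExt z) :=
    (e.contMDiffAt_coord (e.dataChartExt_mem hz)).mdifferentiableAt (by simp)
  have h1 : mfderiv 𝓘(ℝ, E3) 𝓘(ℝ, E3) (e.coord ∘ e.dataChartExt) z = ContinuousLinearMap.id ℝ E3 := by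
    rw [hev.mfderiv_eq, mfderiv_id]
    rfl
  have h2 := mfderiv_comp z hc hd
  have h3 := DFunLike.congr_fun (h2.symm.trans h1) v
  exact h3

/-- **Reading a far field back through `Φₑ`**: if the field `F` of bilinear forms on `TX` equals
the pullback `coord^* H` of a field `H` on `ℝ³` at the point `Φₑ z` (`‖z‖ > R`), then
`(Φₑ^* F) z = H z`. [cite: ONeill1983, Ch. 3, p. 58] -/
theorem pullbackBilin_dataChartExt_apply_of_eq
    {F : Π x : X, TangentSpace (𝓡 3) x →L[ℝ] TangentSpace (𝓡 3) x →L[ℝ] ℝ} {H : E3 → E3 →L[ℝ] E3 →L[ℝ] ℝ}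
    {z : E3} (hz : e.R < ‖z‖)
    (hF : F (e.dataChartExt z) = pullbackBilin (I := 𝓘(ℝ, E3)) (I' := 𝓡 3) e.coord
      (show Π w : E3, TangentSpace 𝓘(ℝ, E3) w →L[ℝ] TangentSpace 𝓘(ℝ, E3) w →L[ℝ] ℝ from H) (e.dataChartExt z)) :
    pullbackBilin (I := 𝓡 3) (I' := 𝓘(ℝ, E3)) e.dataChartExt F z =
      (show TangentSpace 𝓘(ℝ, E3) z →L[ℝ] TangentSpace 𝓘(ℝ, E3) z →L[ℝ] ℝ from H z) := by
  ext v w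
  rw [pullbackBilin_apply, hF, pullbackBilin_apply, e.mfderiv_coord_mfderiv_dataChartExt hz,
    e.mfderiv_coord_mfderiv_dataChartExt hz, e.coord_dataChartExt_of_lt hz]

/-! ### The range of `Φₑ ∘ f` when the range of `f` contains the exterior of a ball -/

omit [TopologicalSpace A] in
/-- If the range of `f` contains `{ρ < ‖z‖}` then the range of `Φₑ ∘ f` contains the far region
`e.far ρ`. [cite: Bartnik1986, §1] -/
theorem far_subset_range_dataChartExt_comp {f : A → E3} {ρ : ℝ}
    (hf : ∀ z : E3, ρ < ‖z‖ → z ∈ Set.range f) : e.far ρ ⊆ Set.range (e.dataChartExt ∘ f) := by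
  intro x hx
  obtain ⟨hxU, hlt⟩ := e.mem_far_iff_coord.1 hx
  obtain ⟨a, ha⟩ := hf _ hlt
  exact ⟨a, by rw [Function.comp_apply, ha, e.dataChartExt_coord_of_mem hxU]⟩

/-- **For the sole end, the range of `Φₑ ∘ f` has compact complement** when `f : A → ℝ³` is an
open embedding ranging beyond radius `R` whose range has compact complement (the complement of
the range of `Φₑ ∘ f` is closed and lies in the compact complement of a far region).
[cite: SchoenYau1979] -/
theorem isCompact_compl_range_dataChartExt_comp {f : A → E3} (he : e.IsSoleEnd)
    (hf : IsOpenEmbedding f) (hR : ∀ a, e.R < ‖f a‖) (hcpt : IsCompact (Set.range f)ᶜ) :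
    IsCompact (Set.range (e.dataChartExt ∘ f))ᶜ := by
  -- the complement of the range of `f` is bounded: inside `ball 0 ρ₀`
  obtain ⟨ρ₀, hρ₀⟩ := hcpt.isBounded.subset_ball 0
  set ρ : ℝ := max ρ₀ e.R with hρ
  have hfar : ∀ z : E3, ρ < ‖z‖ → z ∈ Set.range f := by
    intro z hz
    by_contra h
    have hmem := hρ₀ h
    rw [Metric.mem_ball, dist_zero_right] at hmem
    exact (lt_irrefl _) ((le_max_left ρ₀ e.R).trans_lt (hz.trans hmem))
  have hsub : (Set.range (e.dataChartExt ∘ f))ᶜ ⊆ (e.far ρ)ᶜ :=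
    Set.compl_subset_compl.2 (e.far_subset_range_dataChartExt_comp hfar)
  obtain ⟨R', -, hR'⟩ := he.exists_far_disjoint_isCompact_compl (isCompact_empty)
  have hK : IsCompact (e.far (max ρ R'))ᶜ := (hR' (max ρ R') (le_max_right _ _)).2
  refine hK.of_isClosed_subset (e.isOpenEmbedding_dataChartExt_comp hf hR).isOpen_range.isClosed_compl ?_
  exact hsub.trans (Set.compl_subset_compl.2 (e.far_mono (le_max_left _ _)))

end AFEnd

end Literature.Geometry.Lorentzian

end
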